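import Summits.BirchSwinnertonDyer.BirchSwinnertonDyer.Theses.KatoDescentTamePotSupersingular
import Summits.BirchSwinnertonDyer.BirchSwinnertonDyer.Theorems.KatoDescentPotSupersingularZetaLineRankZero
import HarnessLib

/-!
# Crux M of route `KatoDescentTamePotSupersingular` (K8-t′) BY NAME from TWO held inputs — modularity (20296) and Kato's CORE member
# package (27962) — with NO Gross–Zagier–Kolyvagin (child 20298 IDLE) and NO Poitou–Tate binder: typed closers over the live aliases
# (crux M = stmt-BirchSwinnertonDyer-19196 `ReducibleKatoMember`; `--supports`, closes nothing)

Seat `bsd-potss-rkm` g25 (prover; cell `bsd-potss`).  HONEST FRAMING: BSD is not proved by any of this; nothing is booked; the held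
input `Kato2004.exists_memberHullZetaCoreInputs` (child 27962; size XL) is unchanged and un-discharged.  What is new (route-free theorem
`ZetaLineRankZero.katoMemberShaBoundOfReducible_of_newform_of_coreInputs`, this seat): `W_K(ℚ)` finite is a CONSEQUENCE of clause (b′) of the
core package (Kato Cor. 14.3 / Thm. 14.5), so the live 4-ary glue 27964 `ReducibleKatoMemberOfCoreInputs`
(`PublishedInputNewformKatoZ → PublishedInputMemberHullZetaCore → HeldPoitouTateSelmerDualityQ → PublishedInputRankEqAnalyticRankZ → M`) is
implied by the 2-ary theorem below; children 27963 (PT, closed) and 20298 (GZK, held) are IDLE for M.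

* `tameReducibleKatoMember_of_newformZ_of_coreInputs : PublishedInputNewformKatoZ → PublishedInputMemberHullZetaCore → ReducibleKatoMember`
* `tameReducibleKatoMember_of_newform_of_coreInputs` — Literature-constant form; `tameReducibleKatoMemberOfCoreInputs_gzkIdle` — the 4-ary glue
  shape with binders 3–4 unused.

References: K. Kato, Astérisque 295 (2004), Cor. 14.3, Thm. 14.5 (pp. 235–236), Prop. 14.16 (2) (pp. 244–245) [Kato2004Asterisque];
C. Breuil, B. Conrad, F. Diamond, R. Taylor, J. Amer. Math. Soc. 14 (2001) [BreuilConradDiamondTaylor2001].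
-/

-- the summit and its single problem are both named `BirchSwinnertonDyer` (registry layout D-0017)
set_option linter.dupNamespace false
set_option autoImplicit false

noncomputable section

open Literature.NumberTheory.EllipticCurves Literature.NumberTheory.EllipticCurves.ModularForms
  Literature.NumberTheory.EllipticCurves.Kato2004
open Summit.BirchSwinnertonDyer.BirchSwinnertonDyer.Theorems

namespace Summit.BirchSwinnertonDyer.BirchSwinnertonDyer.Theorems.CoreInputsNoGZK

/-- **Crux M (K8-t′) from modularity and the core package, Literature-constant form** — no GZK, no Poitou–Tate binder.
[cite: Kato2004Asterisque, Cor. 14.3, Thm. 14.5 (pp. 235–236), Prop. 14.16 (2) (pp. 244–245)] -/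
theorem tameReducibleKatoMember_of_newform_of_coreInputs (hmod : exists_isNewformOf) (hC : exists_memberHullZetaCoreInputs) :
    Summit.BirchSwinnertonDyer.BirchSwinnertonDyer.Theses.KatoDescentTamePotSupersingular.ReducibleKatoMember :=
  ZetaLineRankZero.katoMemberShaBoundOfReducible_of_newform_of_coreInputs hmod hC

/-- **Crux M (K8-t′) BY NAME from the aliases `PublishedInputNewformKatoZ` (20296) and `PublishedInputMemberHullZetaCore` (27962)** — the GZK child
20298 `PublishedInputRankEqAnalyticRankZ` is not used. [cite: Kato2004Asterisque, Cor. 14.3, Thm. 14.5 (pp. 235–236), Prop. 14.16 (2) (pp. 244–245)]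
[cite: BreuilConradDiamondTaylor2001, Thm. A] -/
theorem tameReducibleKatoMember_of_newformZ_of_coreInputs :
    Summit.BirchSwinnertonDyer.BirchSwinnertonDyer.Theses.KatoDescentTamePotSupersingular.PublishedInputNewformKatoZ →
    Summit.BirchSwinnertonDyer.BirchSwinnertonDyer.Theses.KatoDescentTamePotSupersingular.PublishedInputMemberHullZetaCore →
    Summit.BirchSwinnertonDyer.BirchSwinnertonDyer.Theses.KatoDescentTamePotSupersingular.ReducibleKatoMember :=
  fun hmod hC => tameReducibleKatoMember_of_newform_of_coreInputs hmod hC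

/-- **The live glue 27964 `ReducibleKatoMemberOfCoreInputs` with its Poitou–Tate and GZK binders IDLE.**
[cite: Kato2004Asterisque, Cor. 14.3, Thm. 14.5 (pp. 235–236)] -/
theorem tameReducibleKatoMemberOfCoreInputs_gzkIdle :
    Summit.BirchSwinnertonDyer.BirchSwinnertonDyer.Theses.KatoDescentTamePotSupersingular.PublishedInputNewformKatoZ →
    Summit.BirchSwinnertonDyer.BirchSwinnertonDyer.Theses.KatoDescentTamePotSupersingular.PublishedInputMemberHullZetaCore →
    Summit.BirchSwinnertonDyer.BirchSwinnertonDyer.Theses.KatoDescentTamePotSupersingular.HeldPoitouTateSelmerDualityQ →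
    Summit.BirchSwinnertonDyer.BirchSwinnertonDyer.Theses.KatoDescentTamePotSupersingular.PublishedInputRankEqAnalyticRankZ →
    Summit.BirchSwinnertonDyer.BirchSwinnertonDyer.Theses.KatoDescentTamePotSupersingular.ReducibleKatoMember :=
  fun hmod hC _ _ => tameReducibleKatoMember_of_newform_of_coreInputs hmod hC

end Summit.BirchSwinnertonDyer.BirchSwinnertonDyer.Theorems.CoreInputsNoGZK

end
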